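import Summits.NavierStokesRegularity.NavierStokesRegularity.Theorems.CircuitTrace.Negative.ValveBudgetNeedsCyclic

/-!
# `CircuitTrace` (stmt-NavierStokesRegularity-1836), line `tilted-trace-gronwall`:
# stub S2b (`stub_quietImpliesRegular`) NEEDS the critical amplitude bound `hA` below the quiet line

Negative-side support (drefute seat). `QuietImpliesRegularWithoutAmplitude` is the lead's registered
stub `stub_quietImpliesRegular` (skeleton da3ad81a) with the single hypothesis
`∀ t ∈ [0,T), ∀ i n, lam^{n/5}|X_{i,n}(t)| ≤ A` deleted, everything else verbatim. It is FALSE: for the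
symmetric, non-cyclic self-interaction circuit `selfCoeff = [μ = none]` of `ValveBudgetNeedsCyclic.lean`
(`m = 1`, `lam = 2`) the Riccati
mode `X₀(t) = 2/(2 - eᵗ)` at scale `0` (all other modes `0`) solves the circuit on `(0, log 2)`, is
`H¹⁰`-bounded on every `[0,T']`, `T' < log 2`, every scale `j ≥ 1` is `ε`-quiet for every `ε > 0`, and
yet `X₀ ↑ ∞` at `T = log 2`. So in S2b the scales BELOW the quiet half-line are controlled by `hA` and by
nothing else in the hypothesis list (absent (4.3): with cyclic cancellation the low block's energy
would be controlled by the flux through the quiet cut instead — not claimed here).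

No statement here asserts a `Theses` decl positively. [folklore]
-/

noncomputable section

set_option linter.dupNamespace false

namespace Summit.NavierStokesRegularity.NavierStokesRegularity.Theorems.CircuitTrace.Negative

open Finset Real Set


/-- Stub S2b (`stub_quietImpliesRegular`) of line `tilted-trace-gronwall` with the critical amplitude
hypothesis `hA` deleted (the bound `A` is then an idle parameter). -/
def QuietImpliesRegularWithoutAmplitude : Prop :=
    ∀ lam : ℝ, 1 < lam → ∀ (m : ℕ) (coeff : Fin m → Fin m → Fin m → Option (Fin 3) → ℝ) (_A : ℝ),
    ∃ ε₀ : ℝ, 0 < ε₀ ∧ ∀ (T : ℝ) (X : Fin m → ℤ → ℝ → ℝ), 0 < T →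
    (∀ (i : Fin m) (n : ℤ), ∀ t ∈ Set.Ioo 0 T, HasDerivAt (X i n) (circuitRHS lam coeff X i n t) t) →
    (∀ (i : Fin m) (n : ℤ) (t : ℝ), n < 0 → X i n t = 0) →
    (∀ T' ∈ Set.Ioo 0 T, ∃ C : ℝ, ∀ (i : Fin m) (n : ℤ), ∀ t ∈ Set.Icc 0 T',
      lam ^ ((4 : ℝ) * n) * |X i n t| ≤ C) →
    ∀ n : ℤ, 0 ≤ n → ∀ t₁ ∈ Set.Ioo 0 T,
    (∀ (i : Fin m) (j : ℤ), n ≤ j → ∀ t ∈ Set.Ico t₁ T, lam ^ ((1 / 5 : ℝ) * j) * |X i j t| ≤ ε₀) →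
    ∃ C : ℝ, ∀ (i : Fin m) (j : ℤ), ∀ t ∈ Set.Ico 0 T, lam ^ ((4 : ℝ) * j) * |X i j t| ≤ C

/-- The Riccati mode `y(t) = 2 / (2 - eᵗ)`: solves `ẏ = -y + y²`, `y(0) = 2`, blows up at `log 2`. -/
def riccati (t : ℝ) : ℝ := 2 / (2 - Real.exp t)

/-- The Riccati denominator is positive before `log 2`. -/
theorem two_sub_exp_pos {t : ℝ} (ht : t < Real.log 2) : 0 < 2 - Real.exp t := by
  have : Real.exp t < 2 := by
    calc Real.exp t < Real.exp (Real.log 2) := Real.exp_lt_exp.mpr ht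
      _ = 2 := Real.exp_log (by norm_num)
  linarith

/-- The Riccati mode is positive before `log 2`. -/
theorem riccati_pos {t : ℝ} (ht : t < Real.log 2) : 0 < riccati t :=
  div_pos two_pos (two_sub_exp_pos ht)

/-- The Riccati mode solves `ẏ = -y + y²` before `log 2`. -/
theorem hasDerivAt_riccati {t : ℝ} (ht : t < Real.log 2) :
    HasDerivAt riccati (-riccati t + riccati t * riccati t) t := by
  have hden : 2 - Real.exp t ≠ 0 := (two_sub_exp_pos ht).ne'
  have h1 : HasDerivAt (fun s => 2 - Real.exp s) (-Real.exp t) t := by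
    simpa using (Real.hasDerivAt_exp t).const_sub 2
  have h2 := (h1.inv hden).const_mul 2
  have heq : riccati = fun s => 2 * (2 - Real.exp s)⁻¹ := by
    funext s; simp [riccati, div_eq_mul_inv]
  have h3 : HasDerivAt riccati (2 * (-(-Real.exp t) / (2 - Real.exp t) ^ 2)) t := by
    rw [heq]; exact h2
  refine h3.congr_deriv ?_
  unfold riccati
  field_simp
  ring

/-- `riccati` is monotone on `(-∞, log 2)`: the denominator decreases and stays positive. -/
theorem riccati_mono {s t : ℝ} (hst : s ≤ t) (ht : t < Real.log 2) : riccati s ≤ riccati t := by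
  unfold riccati
  have hs := two_sub_exp_pos (lt_of_le_of_lt hst ht)
  have htt := two_sub_exp_pos ht
  apply div_le_div_of_nonneg_left (by norm_num) htt
  linarith [Real.exp_le_exp.mpr hst]

/-- The witness: the Riccati mode at scale `0`, nothing elsewhere. -/
def riccatiX : Fin 1 → ℤ → ℝ → ℝ := fun _ n t => if n = 0 then riccati t else 0

/-- **S2b needs `hA`.** The amplitude-free variant of `stub_quietImpliesRegular` is false. -/
theorem quietImpliesRegular_false_without_amplitude : ¬ QuietImpliesRegularWithoutAmplitude := by
  intro h
  obtain ⟨ε₀, hε₀, hreg⟩ := h 2 (by norm_num) 1 selfCoeff 0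
  set T : ℝ := Real.log 2 with hTdef
  have hT : 0 < T := Real.log_pos (by norm_num)
  have hsol : ∀ (i : Fin 1) (n : ℤ), ∀ t ∈ Set.Ioo 0 T,
      HasDerivAt (riccatiX i n) (circuitRHS 2 selfCoeff riccatiX i n t) t := by
    intro i n t ht
    by_cases hn : n = 0
    · subst hn
      have hfun : riccatiX i 0 = riccati := by funext s; simp [riccatiX]
      have hr : circuitRHS 2 selfCoeff riccatiX i 0 t = -riccati t + riccati t * riccati t := by
        rw [circuitRHS_selfCoeff]; simp [riccatiX]
      rw [hr, hfun]
      exact hasDerivAt_riccati ht.2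
    · have hfun : riccatiX i n = fun _ => (0 : ℝ) := by funext s; simp [riccatiX, hn]
      have hr : circuitRHS 2 selfCoeff riccatiX i n t = 0 := by
        rw [circuitRHS_selfCoeff]; simp [riccatiX, hn]
      rw [hr, hfun]
      exact hasDerivAt_const t 0
  have hcut : ∀ (i : Fin 1) (n : ℤ) (t : ℝ), n < 0 → riccatiX i n t = 0 := by
    intro i n t hn; simp [riccatiX, show n ≠ 0 by omega]
  have hapr : ∀ T' ∈ Set.Ioo 0 T, ∃ C : ℝ, ∀ (i : Fin 1) (n : ℤ), ∀ t ∈ Set.Icc 0 T',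
      (2 : ℝ) ^ ((4 : ℝ) * n) * |riccatiX i n t| ≤ C := by
    intro T' hT'
    refine ⟨riccati T', fun i n t ht => ?_⟩
    by_cases hn : n = 0
    · subst hn
      simp only [riccatiX, if_true, Int.cast_zero, mul_zero, Real.rpow_zero, one_mul]
      rw [abs_of_pos (riccati_pos (lt_of_le_of_lt ht.2 hT'.2))]
      exact riccati_mono ht.2 hT'.2
    · simp only [riccatiX, hn, if_false, abs_zero, mul_zero]
      exact (riccati_pos hT'.2).le
  have ht₁ : T / 2 ∈ Set.Ioo 0 T := ⟨by linarith, by linarith⟩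
  have hquiet : ∀ (i : Fin 1) (j : ℤ), (1 : ℤ) ≤ j → ∀ t ∈ Set.Ico (T / 2) T,
      (2 : ℝ) ^ ((1 / 5 : ℝ) * j) * |riccatiX i j t| ≤ ε₀ := by
    intro i j hj t _
    simp only [riccatiX, show j ≠ 0 by omega, if_false, abs_zero, mul_zero]
    exact hε₀.le
  obtain ⟨C, hC⟩ := hreg T riccatiX hT hsol hcut hapr 1 zero_le_one (T / 2) ht₁ hquiet
  -- evaluate at scale 0 and a time close to log 2
  set c : ℝ := max C 1 + 1 with hcdef
  have hc1 : 2 ≤ c := by have := le_max_right C 1; rw [hcdef]; linarith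
  have hcC : C < c := by have := le_max_left C 1; rw [hcdef]; linarith
  have hc0 : 0 < c := by linarith
  set t : ℝ := Real.log (2 - 1 / c) with htdef
  have harg : 1 ≤ 2 - 1 / c := by
    have : 1 / c ≤ 1 := by rw [div_le_one hc0]; linarith
    linarith
  have harg0 : 0 < 2 - 1 / c := by linarith
  have ht0 : 0 ≤ t := Real.log_nonneg harg
  have htT : t < T := by
    rw [htdef, hTdef]
    have hc' : (0 : ℝ) < 1 / c := one_div_pos.mpr hc0
    exact Real.log_lt_log harg0 (by linarith)
  have hval : riccati t = 2 * c := by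
    unfold riccati
    rw [htdef, Real.exp_log harg0]
    field_simp
    ring
  have := hC 0 0 t ⟨ht0, htT⟩
  simp only [riccatiX, if_true, Int.cast_zero, mul_zero, Real.rpow_zero, one_mul] at this
  rw [abs_of_pos (riccati_pos htT), hval] at this
  linarith

end Summit.NavierStokesRegularity.NavierStokesRegularity.Theorems.CircuitTrace.Negative

end
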